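import Summits.CriticalPhenomena.PercolationContinuityZ3.Theorems.PercNearOneGluingNoHeavyPcintBSMXSym2
import Summits.CriticalPhenomena.PercolationContinuityZ3.Theorems.PercNearOneGluingNoHeavyPcintBSMKernel
import HarnessLib

/-!
# PCINT lane, PHASE 9 (block renewal with reach-`m` pieces): a fast integer certificate functional in the plane

Cell `prim-pcint`, seat `prim-pcint-1` (gen 17); memo `run/shared/lean/prim/pcint/T-FIBRE-ROUTE.md` §PHASE 9.

With `261` reach-three pieces the PHASE-5 integer functional `BSM.certLHSz` (a double `Finset` sum over `Fin np`
with list-indexed piece data and `Finset` key intersections recomputed for every pair) is too slow for the kernel.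
Here, for `t = 2` transverse axes: transverse edge keys are coded by integers (`BSMR.kcode`,
`(x·1024 + y)·2 + axis`, injective on keys with `|y| ≤ 255`), the code list of a piece `BSMR.tcodes` mirrors
`BSMX.tedges2`, the shared-key count becomes a list count **`BSMR.Sfast`** (`#{b ∈ codes σ' : b + off(y) ∈ codes σ}`;
**`BSMR.S2_eq_Sfast`**), and the certificate functional becomes a double list sum **`BSMR.certFast`** over piece
records `(W, endpoint, codes)` with pair endpoints and pair-indexed tables; **`BSMR.certLHSz_eq_certFast`** is the
bridge to `BSM.certLHSz` (so the kernel theorems of PHASES 5–9 apply verbatim).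
-/

noncomputable section

namespace Summit.CriticalPhenomena.PercolationContinuityZ3.Theorems.Pcint.BSMR

open Finset OSM BSM BSMX Literature.Probability.Percolation Literature.Probability.LatticeModels

variable {np k : ℕ}

/-! ### Integer codes of transverse keys -/

/-- The code of a (vertex, axis) pair: `(x·1024 + y)·2 + axis`. -/
def kcode (v : ℤ × ℤ) (a : Fin 2) : ℤ := (v.1 * 1024 + v.2) * 2 + a

/-- The code of a pair key (time keys, which never occur among transverse keys, get the code of axis `0`). -/
def ecode {k : ℕ} (q : LKey2 k) : ℤ :=
  match q.2 with
  | Sum.inl a => kcode q.1 a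
  | Sum.inr _ => kcode q.1 0

/-- The code list of the transverse keys of a piece started at `u` (mirror of `BSMX.tedges2`). -/
def tcodes : ℤ × ℤ → List (Fin 2 × Bool) → List ℤ
  | _, [] => []
  | u, q :: σ => kcode (if q.2 then u else u + sv2 q) q.1 :: tcodes (u + sv2 q) σ

/-- **The codes of the keys are the code list.** -/
theorem image_ecode_tedges2 (k : ℕ) : ∀ (u : ℤ × ℤ) (σ : List (Fin 2 × Bool)),
    (tedges2 k u σ).image ecode = (tcodes u σ).toFinset
  | u, [] => by simp [tedges2, tcodes]
  | u, q :: σ => by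
    rw [tedges2, tcodes, Finset.image_insert, image_ecode_tedges2 k _ σ, List.toFinset_cons]
    congr 1
    split_ifs <;> rfl

/-- The second coordinate of a step vector is at most one in absolute value. -/
theorem abs_sv2_snd_le (q : Fin 2 × Bool) : |(sv2 q).2| ≤ 1 := by
  obtain ⟨i, b⟩ := q
  unfold sv2 tr2 sv
  fin_cases i <;> cases b <;> simp

/-- Keys of a piece are transverse, with second coordinate within `|σ|` of the start. -/
theorem mem_tedges2 (k : ℕ) : ∀ (u : ℤ × ℤ) (σ : List (Fin 2 × Bool)) (q : LKey2 k), q ∈ tedges2 k u σ →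
    (∃ a, q.2 = Sum.inl a) ∧ |q.1.2 - u.2| ≤ σ.length
  | u, [], q, h => by simp [tedges2] at h
  | u, p :: σ, q, h => by
    rw [tedges2, Finset.mem_insert] at h
    have hs := abs_sv2_snd_le p
    rw [abs_le] at hs
    rcases h with rfl | h
    · refine ⟨?_, ?_⟩
      · split_ifs <;> exact ⟨_, rfl⟩
      · split_ifs <;> simp [abs_le] <;> constructor <;> linarith [hs.1, hs.2]
    · obtain ⟨ha, hb⟩ := mem_tedges2 k _ σ q h
      refine ⟨ha, ?_⟩
      rw [abs_le] at hb ⊢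
      simp only [Prod.snd_add, List.length_cons] at hb ⊢
      push_cast
      constructor <;> linarith [hb.1, hb.2, hs.1, hs.2]

/-- **Injectivity of the code** on transverse keys with small second coordinate. -/
theorem ecode_inj {q q' : LKey2 k} (ha : ∃ a, q.2 = Sum.inl a) (ha' : ∃ a, q'.2 = Sum.inl a)
    (hb : |q.1.2| ≤ 255) (hb' : |q'.1.2| ≤ 255) (h : ecode q = ecode q') : q = q' := by
  obtain ⟨⟨x, y⟩, s⟩ := q
  obtain ⟨⟨x', y'⟩, s'⟩ := q'
  obtain ⟨a, rfl⟩ := ha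
  obtain ⟨a', rfl⟩ := ha'
  simp only [ecode, kcode] at h
  simp only at hb hb'
  rw [abs_le] at hb hb'
  have ha2 := a.2; have ha2' := a'.2
  have e3 : (a : ℤ) = a' := by omega
  have e1 : x = x' := by omega
  have e2 : y = y' := by omega
  subst e1; subst e2
  have : a = a' := Fin.ext (by exact_mod_cast e3)
  subst this
  rfl

/-- The offset of the codes under a shift by `y`. -/
def offOf (y : ℤ × ℤ) : ℤ := (y.1 * 1024 + y.2) * 2

/-- Shifting a transverse key shifts its code. -/
theorem ecode_shift (y : ℤ × ℤ) {q : LKey2 k} (ha : ∃ a, q.2 = Sum.inl a) :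
    ecode (shiftE2 k y q) = ecode q + offOf y := by
  obtain ⟨⟨x₁, x₂⟩, s⟩ := q
  obtain ⟨a, rfl⟩ := ha
  simp only [ecode, shiftE2, kcode, offOf, Function.Embedding.coeFn_mk, Prod.fst_add, Prod.snd_add]
  ring

/-! ### The fast shared-key count -/

/-- **The fast shared key count**: the number of codes `b` of the second piece with `b + off` a code of the first. -/
def Sfast (EA EB : List ℤ) (off : ℤ) : ℕ := (EB.filter fun b => decide (b + off ∈ EA)).length

/-- **`S2 = Sfast`** on the code lists (second list duplicate-free; pieces and shift small). -/
theorem S2_eq_Sfast (pc : Fin np → List (Fin 2 × Bool)) (k : ℕ) (y : Fin 2 → ℤ) (σ σ' : Fin np)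
    {EA EB : List ℤ} (hA : EA = tcodes (0, 0) (pc σ)) (hB : EB = tcodes (0, 0) (pc σ')) (hBn : EB.Nodup)
    (hσ : (pc σ).length ≤ 100) (hσ' : (pc σ').length ≤ 100) (hy : |y 1| ≤ 50) :
    S2 pc k y σ σ' = Sfast EA EB (offOf (tr2 y)) := by
  set TA := tedges2 k (0, 0) (pc σ) with hTA
  set TB := tedges2 k (0, 0) (pc σ') with hTB
  set sh := shiftE2 k (tr2 y) with hsh
  have hy' : |(tr2 y).2| ≤ 50 := hy
  -- smallness
  have smA : ∀ a ∈ TA, (∃ i, a.2 = Sum.inl i) ∧ |a.1.2| ≤ 255 := fun a ha => by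
    obtain ⟨h1, h2⟩ := mem_tedges2 k _ _ a ha
    refine ⟨h1, ?_⟩
    simp only [sub_zero] at h2
    have : ((pc σ).length : ℤ) ≤ 100 := by exact_mod_cast hσ
    exact h2.trans (by linarith)
  have smB : ∀ b ∈ TB, (∃ i, b.2 = Sum.inl i) ∧ |b.1.2| ≤ 100 := fun b hb => by
    obtain ⟨h1, h2⟩ := mem_tedges2 k _ _ b hb
    refine ⟨h1, ?_⟩
    simp only [sub_zero] at h2
    have : ((pc σ').length : ℤ) ≤ 100 := by exact_mod_cast hσ'
    exact h2.trans (by linarith)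
  have smSB : ∀ b ∈ TB, (∃ i, (sh b).2 = Sum.inl i) ∧ |(sh b).1.2| ≤ 255 := fun b hb => by
    obtain ⟨h1, h2⟩ := smB b hb
    refine ⟨h1, ?_⟩
    show |(b.1 + tr2 y).2| ≤ 255
    rw [Prod.snd_add]
    rw [abs_le] at h2 hy' ⊢
    constructor <;> linarith [h2.1, h2.2, hy'.1, hy'.2]
  -- step 1: the intersection as a filtered image
  have step1 : TA ∩ TB.map sh = (TB.filter fun b => sh b ∈ TA).map sh := by
    ext q
    simp only [Finset.mem_inter, Finset.mem_map, Finset.mem_filter]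
    constructor
    · rintro ⟨hq, b, hb, rfl⟩; exact ⟨b, ⟨hb, hq⟩, rfl⟩
    · rintro ⟨b, ⟨hb, hq⟩, rfl⟩; exact ⟨hq, b, hb, rfl⟩
  -- step 2: the membership test through codes
  have hEA : EA.toFinset = TA.image ecode := by rw [hA, hTA, image_ecode_tedges2]
  have hEB : EB.toFinset = TB.image ecode := by rw [hB, hTB, image_ecode_tedges2]
  have step2 : ∀ b ∈ TB, (sh b ∈ TA ↔ ecode b + offOf (tr2 y) ∈ EA) := by
    intro b hb
    rw [← ecode_shift (tr2 y) (smB b hb).1, ← List.mem_toFinset, hEA, Finset.mem_image]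
    constructor
    · intro h; exact ⟨sh b, h, rfl⟩
    · rintro ⟨a, ha, hae⟩
      have := ecode_inj (smA a ha).1 (smSB b hb).1 (smA a ha).2 (smSB b hb).2 hae
      rw [← this]; exact ha
  -- step 3: count
  unfold S2 Sfast
  rw [← hTA, ← hTB, ← hsh, step1, Finset.card_map]
  have hinjB : Set.InjOn ecode (TB : Set (LKey2 k)) := fun b hb b' hb' h =>
    ecode_inj (smB b hb).1 (smB b' hb').1 ((smB b hb).2.trans (by norm_num)) ((smB b' hb').2.trans (by norm_num)) h
  rw [Finset.filter_congr (fun b hb => step2 b hb),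
    ← Finset.card_image_of_injOn (hinjB.mono (Finset.coe_subset.2 (Finset.filter_subset _ _)))]
  have step3 : (TB.filter fun b => ecode b + offOf (tr2 y) ∈ EA).image ecode =
      (TB.image ecode).filter fun c => c + offOf (tr2 y) ∈ EA := by
    ext c
    simp only [Finset.mem_image, Finset.mem_filter]
    constructor
    · rintro ⟨b, ⟨hb, hp⟩, rfl⟩; exact ⟨⟨b, hb, rfl⟩, hp⟩
    · rintro ⟨⟨b, hb, rfl⟩, hp⟩; exact ⟨b, ⟨hb, hp⟩, rfl⟩
  rw [step3, ← hEB, ← List.toFinset_card_of_nodup (hBn.filter _), List.toFinset_filter]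
  congr 1
  ext b
  simp only [Finset.mem_filter, decide_eq_true_eq]

/-! ### The fast functional -/

/-- One pair term of the integer certificate functional on piece records `(W, endpoint, codes)` (cf. `BSM.certLHSz`). -/
def termF (k A B E : ℕ) (V0p V1p : ℤ × ℤ → ℕ) (y : ℤ × ℤ) (off : ℤ) (P Q : ℕ × (ℤ × ℤ) × List ℤ) : ℤ :=
  let s := Sfast P.2.2 Q.2.2 off
  let n := s + (if P.2.1 = Q.2.1 + y then 1 else 0)
  let uo := y + (Q.2.1 - P.2.1)
  ((P.1 * Q.1 : ℕ) : ℤ) *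
    ((((A ^ n * B ^ (E - n) : ℕ) : ℤ) - ((B ^ E : ℕ) : ℤ)) * ((V0p uo : ℕ) : ℤ) +
      ((k - 1 : ℕ) : ℤ) * ((((A ^ s * B ^ (E - s) : ℕ) : ℤ) - ((B ^ E : ℕ) : ℤ)) * ((V1p uo : ℕ) : ℤ)))

/-- **The fast integer certificate functional**: a double list sum over the piece records. -/
def certFast (PL : List (ℕ × (ℤ × ℤ) × List ℤ)) (k A B E : ℕ) (V0p V1p : ℤ × ℤ → ℕ) (y : ℤ × ℤ) (off : ℤ) : ℤ :=
  (PL.map fun P => (PL.map fun Q => termF k A B E V0p V1p y off P Q).sum).sum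

/-- `tr2` is compatible with subtraction. -/
theorem tr2_sub (v w : Fin 2 → ℤ) : tr2 (v - w) = tr2 v - tr2 w := rfl

/-- **The bridge**: `BSM.certLHSz` with the fast count, pair-indexed tables and list-tabulated piece data equals
`BSMR.certFast`. -/
theorem certLHSz_eq_certFast (PL : List (ℕ × (ℤ × ℤ) × List ℤ)) (hlen : PL.length = np)
    (pe : Fin np → (Fin 2 → ℤ)) (W : Fin np → ℕ) (EC : Fin np → List ℤ)
    (hPL : ∀ σ : Fin np, PL.getD σ (0, (0, 0), []) = (W σ, tr2 (pe σ), EC σ))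
    (k A B E : ℕ) (V0p V1p : ℤ × ℤ → ℕ) (y : Fin 2 → ℤ) :
    certLHSz pe (fun y' σ σ' => Sfast (EC σ) (EC σ') (offOf (tr2 y'))) W k A B E
        (fun u => V0p (tr2 u)) (fun u => V1p (tr2 u)) y =
      certFast PL k A B E V0p V1p (tr2 y) (offOf (tr2 y)) := by
  subst hlen
  have hget : ∀ σ : Fin PL.length, PL[(σ : ℕ)] = (W σ, tr2 (pe σ), EC σ) := fun σ => by
    rw [← hPL σ, List.getD_eq_getElem _ _ σ.2]
  -- sums over `Fin PL.length` as sums over the list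
  have hsum : ∀ (f : Fin PL.length → ℤ) (F : ℕ × (ℤ × ℤ) × List ℤ → ℤ),
      (∀ i : Fin PL.length, f i = F PL[(i : ℕ)]) → ∑ i, f i = (PL.map F).sum := by
    intro f F h
    have : List.ofFn f = PL.map F := by
      apply List.ext_getElem (by simp)
      intro i h1 h2
      rw [List.getElem_ofFn, List.getElem_map, h ⟨i, by simpa using h1⟩]
    rw [← List.sum_ofFn, this]
  unfold certLHSz certFast
  refine hsum _ _ fun σ => ?_
  refine hsum _ _ fun σ' => ?_
  rw [hget σ, hget σ']
  unfold termF
  have e1 : (tr2 (pe σ) = tr2 (pe σ') + tr2 y) ↔ (pe σ = pe σ' + y) := by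
    rw [← tr2_add, tr2_injective.eq_iff]
  have e2 : tr2 y + (tr2 (pe σ') - tr2 (pe σ)) = tr2 (y + (pe σ' - pe σ)) := by rw [tr2_add, tr2_sub]
  simp only [e1, e2]

end Summit.CriticalPhenomena.PercolationContinuityZ3.Theorems.Pcint.BSMR

end
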